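import Summits.ABC.IUTFork.Joshi.TestGenuinePinsDividingLine
import Summits.ABC.IUTFork.Thm311RealIsmDHMoverOddClassification
import Summits.ABC.IUTFork.Thm311RealIsmDHDegOne
import HarnessLib

/-!
# Branch E TEST — the DIVIDING LINE of the genuine-carrier pins (R-J row Y-26): the fixed-ball shape list is EXACT
# (each listed shape IS (Ind2)-fixed; with p489924 the unit ball is fixed IFF the place is on the list)

Proof-only rider (abc-iut cell, D-0079 R-J «Joshi Y-discharge census», row Y-26; seat abc-iut-E-t41, gen 4; 0 definitions, no `Prop`
fact, FACT rows used: none) to this seat's `Joshi/TestGenuinePinsDividingLine.lean` (p489924, (B2): «if every element of Dupuy–Hilado's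
(Ind2) group fixes the unit ball `𝒪_v` then `F_v` is unramified over an odd prime, or `ℚ_2`, or `ℚ_3(ζ_3)`-shaped, or
`ℚ_2(√3)`-shaped») and to abc-iut-E-t43's `Joshi/TestGenuinePinsVacuityNeRat.lean` (p489730: «`F ≠ ℚ` ⇒ pins EMPTY unless a `(2,1)`-place
over `3` contains `ζ_3` or a `(2,1)`-place over `2` has `log_2(𝒪_v^×) = 2𝒪_v`»).  The adversary question for both files (abc-iut-E-plan
READ ROUTING 2026-08-27T03:04:47Z: «are the two excluded local types exactly the FIXED ones») is answered here in kernel, for the ANALYTIC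
logarithm (the one of `settingPrVolSharp`): EACH LISTED SHAPE IS (Ind2)-FIXED, so the list is EXACT —

* `forall_ismDH_image_closedBall_one_eq_of_ramificationIdx_eq_one_odd` — unramified over an odd prime: fixed (abc-iut-w5-d180's
  `forall_ismDH_image_closedBall_eq_of_unramified`, the balls-only shadow of abc-iut-w5-d216's isometry theorem);
* `forall_ismDH_image_closedBall_one_eq_of_localDeg_eq_one` — `(e, f) = (1, 1)`, any `p` (in particular `ℚ_2`): fixed (abc-iut-w5-d216's
  degree-one isometry theorem `norm_of_map_eq_of_mem_ismDH_of_localDeg_eq_one`, read through c312-5's identities `toR`/`ofR`);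
* `forall_ismDH_image_closedBall_one_eq_of_zeta_three_shape` — `v ∣ 3`, `(e, f) = (2, 1)`, `#μ_{3^∞}(F_v) = 3`: fixed (abc-iut-c312-14's
  CLASSIFICATION OVER AN ODD PRIME `forall_ismDH_image_closedBall_eq_iff_of_odd`, row «`F_v ∋ ζ_p`, `e = p − 1`, `f = 1`, `e ∣ j − 2`» at
  `p = 3`, `j = 0`);
* `forall_ismDH_image_closedBall_one_eq_of_logUnits_eq_closedBall_norm_two` — `v ∣ 2`, `e = 2`, `log_2(𝒪_v^×) = 2𝒪_v`: fixed
  (abc-iut-w4-d017's PARITY LEMMA at `j₀ = 2`, `j = 0`: `2 ∣ 0 − 2`);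
* **`forall_ismDH_image_closedBall_one_eq_iff_localShape`** — THE DIVIDING LINE AT ONE PLACE, EXACT: at `v ∣ p`, EVERY element of
  `Real.ismDH (analyticLogv F) (inr v)` fixes `𝒪_v` **iff** (`e = 1` ∧ (`p = 2 → f = 1`)) ∨ (`p = 3` ∧ `(e, f) = (2, 1)` ∧ `#μ_{3^∞} = 3`) ∨
  (`p = 2` ∧ `(e, f) = (2, 1)` ∧ `log_2(𝒪_v^×) = 2𝒪_v`) (⇒ p489924's `localShape_…`; ⇐ the four items above);
* `forall_ismDH_image_closedBall_one_eq_iff_of_two_le_ramificationIdx` — at a RAMIFIED place: fixed iff `ℚ_3(ζ_3)`- or `ℚ_2(√3)`-shaped —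
  the two types excluded in p489730 / named in p489924 (B3) are EXACTLY the ramified fixed ones.

HONEST SCOPE.  Statements about Dupuy–Hilado's typed (Ind2) group on the unit ball of one completion; (Ind2)-fixedness of `𝒪_v` at every
place is NECESSARY for the pins (p489924 (B1)), not sufficient — inhabitation is known at `F = ℚ` only (p463284/p463655); nothing here bears
on print's (xi-e)/(xi-f); locates / conditionally verifies; no abc claim. [claim: Mochizuki2012, status: disputed] [cite: DupuyHilado2025, §4.9]
[cite: WeilBNT1967, Ch. II §2, Th. 1–2] [cite: NeukirchANT1999, Ch. II Prop. (5.5), (5.7), (7.13)]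
-/

noncomputable section

open Set Function NumberField IsDedekindDomain Metric
open scoped Pointwise

namespace Summit.ABC.IUTFork.Joshi

open Thm311 Thm311.Real Cor312 Cor312Vol Literature.IUT.LogThetaLattice Literature.IUT.LogVolume
  Literature.IUT.HodgeTheaters Literature.NumberTheory.NumberFields
open Literature.NumberTheory.GaloisRepresentations.Ultrametric

namespace GenuinePinsDividingLine

variable {F : Type} [Field F] [NumberField F] (p : ℕ) [hp : Fact p.Prime] (v : HeightOneSpectrum (𝓞 F))
  (hv : ((p : ℕ) : 𝓞 F) ∈ v.asIdeal)

/-! ## 1. Each listed shape is (Ind2)-fixed -/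

/-- **Unramified over an odd prime ⇒ the unit ball is (Ind2)-fixed** (abc-iut-w5-d180's `forall_ismDH_image_closedBall_eq_of_unramified`
at `t = 1`; any logarithm analytic at `p`). [cite: DupuyHilado2025, §4.9] [cite: WeilBNT1967, Ch. II §2, Th. 2] -/
theorem forall_ismDH_image_closedBall_one_eq_of_ramificationIdx_eq_one_odd {logv : PadicLogs F} (hlog : LogvAnalyticAt p logv)
    (hp2 : p ≠ 2) (he : v.asIdeal.ramificationIdx ℤ = 1) :
    ∀ g ∈ ismDH logv (.inr v),
      (fun a => toR p v hv (g (ofR p v hv a))) '' closedBall (0 : RescaledCompletion F p v hv) 1 = closedBall 0 1 := by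
  have hp2' : 2 < p := by have := hp.out.two_le; omega
  have h := forall_ismDH_image_closedBall_eq_of_unramified hlog hp2' he (one_ne_zero : (1 : RescaledCompletion F p v hv) ≠ 0)
  rwa [norm_one] at h

/-- **Local degree one (`(e, f) = (1, 1)`, any `p` — in particular the `ℚ_2`-shape) ⇒ the unit ball is (Ind2)-fixed** for the ANALYTIC
logarithm: abc-iut-w5-d216's degree-one isometry theorem read through c312-5's identities `toR`/`ofR`. [cite: DupuyHilado2025, §4.9] -/
theorem forall_ismDH_image_closedBall_one_eq_of_localDeg_eq_one (he : v.asIdeal.ramificationIdx ℤ = 1)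
    (hf : v.asIdeal.inertiaDeg ℤ = 1) :
    ∀ g ∈ ismDH (analyticLogv F) (.inr v : Thm311.Real.Place F),
      (fun a => toR p v hv (g (ofR p v hv a))) '' closedBall (0 : RescaledCompletion F p v hv) 1 = closedBall 0 1 := by
  intro g hg
  have hres : residueChar F v = p :=
    (mem_placesOver_iff_residueChar v).mp ((mem_placesOver_iff v).mpr (liesOver_span_of_natCast_mem F p v hv))
  have hdeg : localDeg F v = 1 := by
    show v.asIdeal.ramificationIdx ℤ * v.asIdeal.inertiaDeg ℤ = 1
    rw [he, hf]
  have hiso : ∀ {φ : Carrier (.inr v : Thm311.Real.Place F) ≃ₗ[ℚ] Carrier (.inr v : Thm311.Real.Place F)},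
      φ ∈ ismDH (analyticLogv F) (.inr v : Thm311.Real.Place F) →
        ∀ a : RescaledCompletion F p v hv, ‖toR p v hv (φ (ofR p v hv a))‖ = ‖a‖ :=
    fun hφ a => norm_of_map_eq_of_mem_ismDH_of_localDeg_eq_one p v hv hres hdeg hφ (ofR p v hv a)
  ext y
  simp only [Set.mem_image, mem_closedBall_zero_iff]
  constructor
  · rintro ⟨x, hx, rfl⟩
    rwa [hiso hg]
  · intro hy
    refine ⟨toR p v hv (g.symm (ofR p v hv y)), ?_, ?_⟩
    · rw [hiso (NonIsometryMover.symm_mem_ismDH _ v hg)]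
      exact hy
    · show g (g.symm y) = y
      exact g.apply_symm_apply y

/-- **The `ℚ_3(ζ_3)`-shape (`v ∣ 3`, `(e, f) = (2, 1)`, `#μ_{3^∞}(F_v) = 3`) ⇒ the unit ball is (Ind2)-fixed**: abc-iut-c312-14's
classification over an odd prime, row «`F_v ∋ ζ_3 ≠ 1`, `e = 2 = p − 1`, `f = 1`, `e ∣ 0 − 2`». [cite: DupuyHilado2025, §4.9]
[cite: WeilBNT1967, Ch. II §2, Th. 1–2] [cite: NeukirchANT1999, Ch. II Prop. (5.7), (7.13)] -/
theorem forall_ismDH_image_closedBall_one_eq_of_zeta_three_shape {logv : PadicLogs F} (hlog : LogvAnalyticAt p logv) (hp3 : p = 3)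
    (he : v.asIdeal.ramificationIdx ℤ = 2) (hf : v.asIdeal.inertiaDeg ℤ = 1) (hm : torsionPExp p (RescaledCompletion F p v hv) = 1) :
    ∀ g ∈ ismDH logv (.inr v),
      (fun a => toR p v hv (g (ofR p v hv a))) '' closedBall (0 : RescaledCompletion F p v hv) 1 = closedBall 0 1 := by
  set K := RescaledCompletion F p v hv
  obtain ⟨ϖ, hϖ, -⟩ := exists_isUniformizer_rescaledCompletion F p v hv
  -- a primitive cube root of unity from `#μ_{3^∞} = 3`
  obtain ⟨ζ, hζ⟩ := exists_isPrimitiveRoot_pow_torsionPExp p K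
  rw [hm, pow_one] at hζ
  have hζp : ζ ^ p = 1 := hζ.pow_eq_one
  have hζ1 : ζ ≠ 1 := hζ.ne_one hp.out.one_lt
  have hp2 : p ≠ 2 := by omega
  have h := (forall_ismDH_image_closedBall_eq_iff_of_odd hlog hp2 hϖ 0).2
    (Or.inr ⟨⟨ζ, hζp, hζ1⟩, by rw [he, hp3], hf, by rw [he]; norm_num⟩)
  rwa [zpow_zero, norm_one] at h

/-- **The `ℚ_2(√3)`-shape (`v ∣ 2`, `e(v|2) = 2`, `log_2(𝒪_v^×) = 2𝒪_v`) ⇒ the unit ball is (Ind2)-fixed**: abc-iut-w4-d017's parity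
lemma at `j₀ = 2` (`‖ϖ‖² = ‖2‖`), `j = 0`, `2 ∣ 0 − 2`. [cite: DupuyHilado2025, §4.9] [cite: WeilBNT1967, Ch. II §2, Th. 2]
[cite: NeukirchANT1999, Ch. II Prop. (5.5)] -/
theorem forall_ismDH_image_closedBall_one_eq_of_logUnits_eq_closedBall_norm_two {logv : PadicLogs F}
    (hlog : LogvAnalyticAt p logv) (hp2 : p = 2) (he : v.asIdeal.ramificationIdx ℤ = 2)
    (hΛ : logUnits (RescaledCompletion F p v hv) =
      closedBall (0 : RescaledCompletion F p v hv) ‖(2 : RescaledCompletion F p v hv)‖) :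
    ∀ g ∈ ismDH logv (.inr v),
      (fun a => toR p v hv (g (ofR p v hv a))) '' closedBall (0 : RescaledCompletion F p v hv) 1 = closedBall 0 1 := by
  subst hp2
  set K := RescaledCompletion F 2 v hv
  obtain ⟨ϖ, hϖ, -⟩ := exists_isUniformizer_rescaledCompletion F 2 v hv
  have heK : absRamificationIdx 2 K = 2 := by rw [absRamificationIdx_rescaledCompletion F 2 v hv, he]
  have hΛ' : logUnits K = closedBall (0 : K) ‖(ϖ : K) ^ (2 : ℤ)‖ := by
    rw [hΛ, ← WildQuadraticDyadic.norm_unif_sq_eq_norm_two hϖ heK, norm_zpow]; norm_cast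
  have h := (forall_ismDH_image_closedBall_eq_iff_dvd_sub_of_logUnits_eq hlog v hv hϖ hΛ' 0).2 (by rw [he]; norm_num)
  rwa [zpow_zero, norm_one] at h

/-! ## 2. The dividing line at one place, exact -/

/-- **THE DIVIDING LINE AT ONE PLACE, EXACT** (analytic logarithm): at a finite place `v ∣ p`, EVERY element of Dupuy–Hilado's (Ind2)
group fixes the unit ball `𝒪_v` **iff** `F_v` is unramified over an odd prime or `ℚ_2` (`e = 1`, and `f = 1` if `p = 2`), OR
`ℚ_3(ζ_3)`-shaped (`p = 3`, `(e, f) = (2, 1)`, `#μ_{3^∞} = 3`), OR `ℚ_2(√3)`-shaped (`p = 2`, `(e, f) = (2, 1)`, `log_2(𝒪_v^×) = 2𝒪_v`).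
⇒ p489924's `localShape_of_forall_ismDH_image_closedBall_one_eq`; ⇐ §1. [cite: DupuyHilado2025, §4.9] [cite: WeilBNT1967, Ch. II §2, Th. 1–2]
[cite: NeukirchANT1999, Ch. II Prop. (5.5), (5.7), (7.13)] -/
theorem forall_ismDH_image_closedBall_one_eq_iff_localShape :
    (∀ g ∈ ismDH (analyticLogv F) (.inr v : Thm311.Real.Place F),
      (fun a => toR p v hv (g (ofR p v hv a))) '' closedBall (0 : RescaledCompletion F p v hv) 1 = closedBall 0 1) ↔
    ((v.asIdeal.ramificationIdx ℤ = 1 ∧ (p = 2 → v.asIdeal.inertiaDeg ℤ = 1)) ∨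
     (p = 3 ∧ v.asIdeal.ramificationIdx ℤ = 2 ∧ v.asIdeal.inertiaDeg ℤ = 1 ∧ torsionPExp p (RescaledCompletion F p v hv) = 1) ∨
     (p = 2 ∧ v.asIdeal.ramificationIdx ℤ = 2 ∧ v.asIdeal.inertiaDeg ℤ = 1 ∧
       logUnits (RescaledCompletion F p v hv) =
         closedBall (0 : RescaledCompletion F p v hv) ‖(2 : RescaledCompletion F p v hv)‖)) := by
  have hlog : LogvAnalyticAt p (analyticLogv F) := logvAnalyticAt_analyticLogv (F := F) p
  constructor
  · intro h
    rcases localShape_of_forall_ismDH_image_closedBall_one_eq hlog v hv h with h1 | h3 | ⟨hp2, he, hf, -, hΛ⟩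
    · exact Or.inl h1
    · exact Or.inr (Or.inl h3)
    · exact Or.inr (Or.inr ⟨hp2, he, hf, hΛ⟩)
  · rintro (⟨he, hf⟩ | ⟨hp3, he, hf, hm⟩ | ⟨hp2, he, -, hΛ⟩)
    · by_cases hp2 : p = 2
      · exact forall_ismDH_image_closedBall_one_eq_of_localDeg_eq_one p v hv he (hf hp2)
      · exact forall_ismDH_image_closedBall_one_eq_of_ramificationIdx_eq_one_odd p v hv hlog hp2 he
    · exact forall_ismDH_image_closedBall_one_eq_of_zeta_three_shape p v hv hlog hp3 he hf hm
    · exact forall_ismDH_image_closedBall_one_eq_of_logUnits_eq_closedBall_norm_two p v hv hlog hp2 he hΛ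

/-- **At a RAMIFIED place (`e(v|p) ≥ 2`), exact**: the unit ball is (Ind2)-fixed iff `F_v` is `ℚ_3(ζ_3)`-shaped or `ℚ_2(√3)`-shaped —
the two local types excluded in abc-iut-E-t43's p489730 and named in p489924 (B3) are EXACTLY the ramified fixed ones.
[cite: DupuyHilado2025, §4.9] [cite: WeilBNT1967, Ch. II §2, Th. 1–2] [cite: NeukirchANT1999, Ch. II Prop. (5.5), (5.7), (7.13)] -/
theorem forall_ismDH_image_closedBall_one_eq_iff_of_two_le_ramificationIdx (he2 : 2 ≤ v.asIdeal.ramificationIdx ℤ) :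
    (∀ g ∈ ismDH (analyticLogv F) (.inr v : Thm311.Real.Place F),
      (fun a => toR p v hv (g (ofR p v hv a))) '' closedBall (0 : RescaledCompletion F p v hv) 1 = closedBall 0 1) ↔
    ((p = 3 ∧ v.asIdeal.ramificationIdx ℤ = 2 ∧ v.asIdeal.inertiaDeg ℤ = 1 ∧ torsionPExp p (RescaledCompletion F p v hv) = 1) ∨
     (p = 2 ∧ v.asIdeal.ramificationIdx ℤ = 2 ∧ v.asIdeal.inertiaDeg ℤ = 1 ∧
       logUnits (RescaledCompletion F p v hv) =
         closedBall (0 : RescaledCompletion F p v hv) ‖(2 : RescaledCompletion F p v hv)‖)) := by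
  rw [forall_ismDH_image_closedBall_one_eq_iff_localShape p v hv]
  constructor
  · rintro (⟨h1, -⟩ | h)
    · omega
    · exact h
  · exact Or.inr

end GenuinePinsDividingLine

end Summit.ABC.IUTFork.Joshi

end
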